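import Summits.QuantumFields.BalabanUV.T4Continuum.Support.ShellMeasurePropagatorCombesThomasPrelims

/-!
# `T4Continuum.ShellMeasurePropagatorCombesThomas` — THE ℓ²-SHADOW OF THE PROPAGATOR DECAY ROWS IS SOFT: the second-order
# (Hermitian ∕ skew-split) Combes–Thomas bound for a gapped finite-range matrix, UNIFORM IN THE LATTICE SPACING
(cell `pub-balaban`, sub-cell `t4`, spine estimate NE7c (node U5b); NE7c ROUND-2 crew `t4-ne7c-formalise-*`, unit
`b2b-balaban-t4-ne7c-formalise-leaf-02` gen 13; journal NOTE N-ne7cleaf02g13-1 (2026-08-20, l.22964) for the owner's γ18 «THE FLOOR»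
memo, species (α) «[B9]-type propagator bounds for block-sectioned complexified operators»; owner table
`t4/b2b-balaban-t4-ne7c-p1/LEAVES-NE7c-P1.md` census rows R06∕R09∕R22 (the w-tuple's decay rows `hk𝒢 hkH hkH₁` of every END host since
S80 f3 — [Balaban1985BackgroundPropagators] (3.133)∕Thm 3.3 TYPE, LOCATORS only); file 2∕3; ADDITIVE — imports file 1∕3
`ShellMeasurePropagatorCombesThomasPrelims` (scalar∕Schur∕entry lemmas; itself over the tree's first-order
`Literature/Analysis/Matrix/CoerciveCombesThomas`, [cite: AizenmanWarzel2015 §10.3] there) ONLY and touches NO host; [folklore]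
finite-dimensional linear algebra; 0 `def`, 0 `def … : Prop`, 0 sorry, 0 citation tags of Bałaban's.)

HONEST FRAMING.  Finite four-torus programme, rung (B)+1 only — NOT infinite volume, NOT a mass gap, NOT the Clay problem, NOT
summit progress; (B), `BetaPertHyp`, (B^μ) are not consumed.  NE7c (`T4IndicatorShell.ShellWeightBound` for the cell's
expansions) is NOT PRINTED in [Balaban 1983–89] and NOT PROVED; «NE7c ⇐ the named binders» (trigger c3).  THIS FILE proves a
GENERIC matrix lemma; it reads NO NE7c binder (the END hosts' letter spaces `ℭ 𝔄w` carry (19)-type sup norms, not ℓ²-cell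
blocks), so the census COUNT does not move.  What it documents for the taper memo: of species (α), the ℓ²-MATRIX-ENTRY
exponential decay of the inverse of a gapped, finite-range, Hermitian-up-to-O(η) lattice operator follows from the GAP ROW ALONE,
with a rate per unit COARSE length that does not depend on the lattice spacing η; what stays the wall is (i) the gap itself with
V-uniform constants ([Balaban1985Variational] (29)–(31)∕Prop. 3 TYPE — a HYPOTHESIS here, `hacc`), (ii) the passage from ℓ² matrix
entries to the printed sup-∕Hölder-∕∇-norms per unit cell ((3.133)'s currency; ℓ² → L^∞ on a cell of `η^{−d}` sites is NOT
uniform without local regularity), (iii) block SECTIONING and analyticity in the complexified background beyond the skew-part size.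
Nothing of Bałaban's is asserted, cited or discharged.  HONEST DEPENDENCY (cell): continuum YM on T⁴ ⇐ BetaPertH ∧ nine spine
estimates (0/9 proved); BetaPertH ⇐ (D1) ∧ (D4) ∧ CAP+tail; G-an2-4 gates asym, D1 and NE2/3/4.

THE POINT.  The tree's `accretive_combes_thomas` (Combes–Thomas 1973; Aizenman–Warzel §10.3; Chulaevsky–Suhov 2014 Thm 2.3.3):
for an `m`-accretive range-one `A` with off-site absolute row∕column sums `≤ h`, `h(e^θ − 1) ≤ m∕2` ⟹ `|A⁻¹ᵢⱼ| ≤ (2∕m)e^{−θ·dist(i,j)}`.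
For a nearest-neighbour lattice operator written in FINE units (`A = η²·H`: entries O(1), `h = O(1)`, gap `m_f = η²·m`) this
forces `θ = O(η²)` per fine step = `O(η)` per unit coarse length: NO uniform decay.  The first-order term is wasted: writing the
Combes–Thomas perturbation `A_{lk}(e^{θ(ρ_l − ρ_k)} − 1) = A_{lk}(cosh(θΔ_{lk}) − 1) + A_{lk} sinh(θΔ_{lk})`, the `sinh` part
contributes to `Re⟨v, · v⟩` ONLY through the SKEW part `½(A_{lk} − conj A_{kl})` of `A` (for the Hermitian part it is
skew-Hermitian), so
* `secondOrder_combes_thomas_sets` — the BLOCK form: with skew-part row sums `Σ_{dist≠0}‖A i j − conj(A j i)‖ ≤ 2h_K`, the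
  condition **`h(cosh θ − 1) + h_K sinh θ ≤ m∕2`** gives, for every source `f` supported in a set `Y` and every set `X` at
  distance `≥ n` from `Y`, `Σ_{i∈X}|(A⁻¹f)_i|² ≤ ((2∕m)e^{−θn})²·Σ|f|²` — `‖1_X A⁻¹ 1_Y‖_{ℓ²→ℓ²} ≤ (2∕m)e^{−θ·dist(X,Y)}` with NO
  dependence on `|X|`, `|Y|`, `|ι|` (the cell-to-cell shape of the decay rows, in ℓ²);
* `secondOrder_combes_thomas` — the ENTRY form `|A⁻¹ᵢⱼ| ≤ (2∕m)e^{−θ·dist(i,j)}` (at `h_K = h` the tree's first-order condition,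
  since `cosh θ + sinh θ − 1 = e^θ − 1`);
* file 3 `ShellMeasurePropagatorCombesThomasScaled`: the HERMITIAN form (`h_K = 0`: `h(cosh θ − 1) ≤ m∕2`, rate `θ ≍ √(m∕h)` —
  the «η ↦ Cη^{1∕2}» improvement of Barbaroux–Combes–Hislop, Helv. Phys. Acta 70 (1997) 16, for finite matrices below the
  spectrum) and the η-UNIFORM form (gap `η²m`, skew part `O(η)`, η-FREE condition ⟹ rate `θ` per unit COARSE length for EVERY
  `η ∈ (0,1]`, via file 1's scaling laws `cosh(ηθ) − 1 ≤ η²(cosh θ − 1)`, `sinh(ηθ) ≤ η sinh θ`).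
Pseudo-metric `dist : ι → ι → ℕ` (colour∕block copies of a site at distance 0), range one, column-by-column proof without operator
theory, exactly as in the tree file; Schur's test in the AM–GM form `Σ_{l,k} a_l N_{lk} a_k ≤ R Σ a²` (file 1).
-/

noncomputable section

open Finset
open scoped Matrix ComplexConjugate

namespace Summit.QuantumFields.BalabanUV.T4Continuum.ShellMeasurePropagatorCombesThomas

open Literature.Analysis.Matrix (accretive_combes_thomas norm_star_dotProduct_le_sqrt_mul_sqrt)
open ShellMeasurePropagatorCombesThomasPrelims

/-! ## §2 The second-order Combes–Thomas bound -/

section Main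

variable {ι : Type*} [Fintype ι] [DecidableEq ι]

/-- **The second-order (Hermitian ∕ skew-split) Combes–Thomas bound, BLOCK form** (ℓ²-operator decay between two index
SETS — the shape of a cell-to-cell kernel bound, with NO volume factor).  Let `dist` be an `ℕ`-valued pseudo-metric on the
finite index set `ι`, `A : Matrix ι ι ℂ` range-one (`A i j ≠ 0 → dist i j ≤ 1`) with off-site absolute row and column sums
`≤ h` and off-site SKEW-PART row sums `Σ_{dist i j ≠ 0} ‖A i j − conj(A j i)‖ ≤ 2h_K`; assume `A` is `m`-accretive,
`m Σ|v_i|² ≤ Re Σ conj(v_i)(Av)_i`, `m > 0`, and let `θ ≥ 0` satisfy `h(cosh θ − 1) + h_K sinh θ ≤ m∕2`.  Then `A` is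
invertible and for every source `f` supported in a set `Y` and every set `X` at distance `≥ n` from `Y`:
`Σ_{i∈X} |(A⁻¹f)_i|² ≤ ((2∕m)e^{−θn})² Σ|f|²`, i.e. `‖1_X A⁻¹ 1_Y‖_{ℓ²→ℓ²} ≤ (2∕m)e^{−θ·dist(X,Y)}` whatever the sizes of `X`, `Y`.
Proof (`x = A⁻¹f`, `ρ = dist(·,Y)`, `v = e^{θρ}·x`): `⟨v, f⟩ = ⟨v, Av⟩ + ⟨v, Bv⟩` with `B_{lk} = A_{lk}(e^{θ(ρ_l−ρ_k)} − 1)`;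
split `e^{θΔ} − 1 = (cosh θΔ − 1) + sinh θΔ`; the even part is bounded by Schur with `h(cosh θ − 1)`; for the odd part `T`,
`T + conj T = Σ conj(v_l)(A_{lk} − conj A_{kl}) sinh(θΔ_{lk}) v_k` (antisymmetry of `sinh θΔ`), so `|Re T| ≤ h_K sinh θ·Σ|v|²`;
hence `(m∕2)Σ|v|² ≤ |⟨v,f⟩| ≤ (Σ|v|²)^{1∕2}(Σ|f|²)^{1∕2}` and `e^{θn}‖x|_X‖ ≤ ‖v‖ ≤ (2∕m)‖f‖`.  Nothing depends on `|ι|`,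
`|X|`, `|Y|`. [folklore] -/
theorem secondOrder_combes_thomas_sets (dist : ι → ι → ℕ) (hd0 : ∀ i, dist i i = 0)
    (hds : ∀ i j, dist i j = dist j i) (hdt : ∀ i j k, dist i k ≤ dist i j + dist j k)
    (A : Matrix ι ι ℂ) (hrange : ∀ i j, A i j ≠ 0 → dist i j ≤ 1) (h : ℝ)
    (hrow : ∀ i, ∑ j ∈ univ.filter (fun j => dist i j ≠ 0), ‖A i j‖ ≤ h)
    (hcol : ∀ j, ∑ i ∈ univ.filter (fun i => dist i j ≠ 0), ‖A i j‖ ≤ h)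
    (hK : ℝ) (hskew : ∀ i, ∑ j ∈ univ.filter (fun j => dist i j ≠ 0), ‖A i j - star (A j i)‖ ≤ 2 * hK)
    (m θ : ℝ) (hm : 0 < m) (hθ : 0 ≤ θ)
    (hacc : ∀ v : ι → ℂ, m * ∑ i, ‖v i‖ ^ 2 ≤ (∑ i, star (v i) * (A *ᵥ v) i).re)
    (hsm : h * (Real.cosh θ - 1) + hK * Real.sinh θ ≤ m / 2)
    (Y : Finset ι) (f : ι → ℂ) (hf : ∀ k, k ∉ Y → f k = 0) (X : Finset ι) (n : ℕ)
    (hn : ∀ i ∈ X, ∀ y ∈ Y, n ≤ dist i y) :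
    IsUnit A.det ∧
      ∑ i ∈ X, ‖(A⁻¹ *ᵥ f) i‖ ^ 2 ≤ (2 / m * Real.exp (-(θ * n))) ^ 2 * ∑ k, ‖f k‖ ^ 2 := by
  -- (1) invertibility: the tree's first-order theorem at rate `0`
  have hdet : IsUnit A.det :=
    (accretive_combes_thomas dist hd0 hds hdt A hrange h hrow hcol m 0 hm le_rfl hacc
      (by rw [Real.exp_zero, sub_self, mul_zero]; linarith)).1
  refine ⟨hdet, ?_⟩
  set F : ℝ := ∑ k, ‖f k‖ ^ 2 with hF
  have hF0 : 0 ≤ F := sum_nonneg fun k _ => by positivity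
  -- the empty source: `f = 0`
  by_cases hY : ¬ Y.Nonempty
  · have hf0 : f = 0 := funext fun k => hf k (fun hk => hY ⟨k, hk⟩)
    rw [hf0, Matrix.mulVec_zero]
    simp only [Pi.zero_apply, norm_zero, ne_eq, OfNat.ofNat_ne_zero, not_false_eq_true, zero_pow, sum_const_zero]
    positivity
  rw [not_not] at hY
  -- (2) the solution `x = A⁻¹ f`
  obtain ⟨x, hx⟩ : ∃ x : ι → ℂ, x = A⁻¹ *ᵥ f := ⟨_, rfl⟩
  have hAx : A *ᵥ x = f := by
    rw [hx, Matrix.mulVec_mulVec, Matrix.mul_nonsing_inv _ hdet, Matrix.one_mulVec]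
  -- (3) the distance to `Y`, weights, weighted solution, the even∕odd perturbation factors
  obtain ⟨ρ, hρ⟩ : ∃ ρ : ι → ℝ, ∀ k, ρ k = ((Y.inf' hY fun y => dist k y : ℕ) : ℝ) := ⟨_, fun _ => rfl⟩
  obtain ⟨d, hd⟩ : ∃ d : ι → ℝ, ∀ k, d k = Real.exp (θ * ρ k) := ⟨_, fun _ => rfl⟩
  obtain ⟨v, hv⟩ : ∃ v : ι → ℂ, ∀ k, v k = (d k : ℂ) * x k := ⟨_, fun _ => rfl⟩
  obtain ⟨c, hc⟩ : ∃ c : ι → ι → ℝ, ∀ l k, c l k = Real.cosh (θ * (ρ l - ρ k)) - 1 := ⟨_, fun _ _ => rfl⟩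
  obtain ⟨s, hs⟩ : ∃ s : ι → ι → ℝ, ∀ l k, s l k = Real.sinh (θ * (ρ l - ρ k)) := ⟨_, fun _ _ => rfl⟩
  set S : ℝ := ∑ k, ‖v k‖ ^ 2 with hS
  have hS0 : 0 ≤ S := sum_nonneg fun k _ => by positivity
  have hdpos : ∀ k, 0 < d k := fun k => by rw [hd]; exact Real.exp_pos _
  have hρY : ∀ k ∈ Y, ρ k = 0 := fun k hk => by
    have h1 : (Y.inf' hY fun y => dist k y) ≤ dist k k := Finset.inf'_le _ hk
    rw [hd0] at h1
    rw [hρ, Nat.le_zero.mp h1, Nat.cast_zero]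
  have hdY : ∀ k ∈ Y, d k = 1 := fun k hk => by rw [hd, hρY k hk, mul_zero, Real.exp_zero]
  have hρX : ∀ i ∈ X, (n : ℝ) ≤ ρ i := fun i hi => by
    rw [hρ]; exact_mod_cast Finset.le_inf' _ _ fun y hy => hn i hi y hy
  have hρlk : ∀ l k, |ρ l - ρ k| ≤ dist l k := fun l k => by
    rw [hρ, hρ]; exact abs_infDist_sub_infDist_le dist hds hdt hY l k
  have hc0 : ∀ l k, 0 ≤ c l k := fun l k => by rw [hc]; linarith [Real.one_le_cosh (θ * (ρ l - ρ k))]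
  have hsanti : ∀ l k, s k l = -s l k := fun l k => by
    rw [hs, hs, show θ * (ρ k - ρ l) = -(θ * (ρ l - ρ k)) by ring, Real.sinh_neg]
  obtain ⟨y₀, hy₀⟩ := hY
  have hh0 : 0 ≤ h := (sum_nonneg fun _ _ => norm_nonneg _).trans (hrow y₀)
  have hK0 : 0 ≤ hK := by
    have := (sum_nonneg fun _ _ => norm_nonneg _).trans (hskew y₀); linarith
  -- (4) the conjugation identity `⟨v, f⟩ = Σ_l Σ_k conj(v_l) A_{lk} e^{θ(ρ_l − ρ_k)} v_k`
  have hweights : ∀ l k, ((Real.exp (θ * (ρ l - ρ k)) : ℝ) : ℂ) * (d k : ℂ) = (d l : ℂ) := by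
    intro l k
    have e : Real.exp (θ * (ρ l - ρ k)) * d k = d l := by
      rw [hd, hd, ← Real.exp_add]; ring_nf
    exact_mod_cast e
  have hdf : ∀ l, (d l : ℂ) * f l = f l := fun l => by
    by_cases hl : l ∈ Y
    · rw [hdY l hl, Complex.ofReal_one, one_mul]
    · rw [hf l hl, mul_zero]
  have hident : ∑ l, ∑ k, star (v l) * (A l k * ((Real.exp (θ * (ρ l - ρ k)) : ℝ) : ℂ) * v k) =
      ∑ l, star (v l) * f l := by
    have hAxl : ∀ l, (d l : ℂ) * (A *ᵥ x) l =
        ∑ k, A l k * ((Real.exp (θ * (ρ l - ρ k)) : ℝ) : ℂ) * v k := by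
      intro l
      simp only [Matrix.mulVec, dotProduct]
      rw [mul_sum]
      refine sum_congr rfl fun k _ => ?_
      rw [hv k]
      calc (d l : ℂ) * (A l k * x k) = (((Real.exp (θ * (ρ l - ρ k)) : ℝ) : ℂ) * (d k : ℂ)) * (A l k * x k) := by
            rw [hweights]
        _ = A l k * ((Real.exp (θ * (ρ l - ρ k)) : ℝ) : ℂ) * ((d k : ℂ) * x k) := by ring
    refine sum_congr rfl fun l _ => ?_
    rw [← mul_sum, ← hAxl l, hAx, hdf l]
  -- (5) `Re⟨v, Av⟩ = Re⟨v, f⟩ − Re Q_c − Re Q_s`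
  have hquad : ∑ l, star (v l) * (A *ᵥ v) l = ∑ l, ∑ k, star (v l) * (A l k * v k) := by
    refine sum_congr rfl fun l _ => ?_
    simp only [Matrix.mulVec, dotProduct]
    rw [mul_sum]
  have hdecomp : (∑ l, star (v l) * (A *ᵥ v) l).re =
      (∑ l, star (v l) * f l).re - (∑ l, ∑ k, star (v l) * (A l k * (c l k : ℂ) * v k)).re -
        (∑ l, ∑ k, star (v l) * (A l k * (s l k : ℂ) * v k)).re := by
    rw [← hident, hquad]
    have hsplit : ∀ l k, star (v l) * (A l k * ((Real.exp (θ * (ρ l - ρ k)) : ℝ) : ℂ) * v k) =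
        star (v l) * (A l k * v k) + star (v l) * (A l k * (c l k : ℂ) * v k) +
          star (v l) * (A l k * (s l k : ℂ) * v k) := by
      intro l k
      have her : Real.exp (θ * (ρ l - ρ k)) = 1 + c l k + s l k := by
        rw [hc, hs]; exact exp_eq_one_add_cosh_sub_one_add_sinh _
      have he : ((Real.exp (θ * (ρ l - ρ k)) : ℝ) : ℂ) = 1 + (c l k : ℂ) + (s l k : ℂ) := by
        exact_mod_cast her
      rw [he]; ring
    have hsum3 : ∑ l, ∑ k, star (v l) * (A l k * ((Real.exp (θ * (ρ l - ρ k)) : ℝ) : ℂ) * v k) =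
        (∑ l, ∑ k, star (v l) * (A l k * v k)) + (∑ l, ∑ k, star (v l) * (A l k * (c l k : ℂ) * v k)) +
          ∑ l, ∑ k, star (v l) * (A l k * (s l k : ℂ) * v k) := by
      simp_rw [hsplit, sum_add_distrib]
    rw [hsum3, Complex.add_re, Complex.add_re]
    ring
  -- (6) the even part by Schur: `|Re Q_c| ≤ h(cosh θ − 1)·S`
  have hQc : |(∑ l, ∑ k, star (v l) * (A l k * (c l k : ℂ) * v k)).re| ≤ h * (Real.cosh θ - 1) * S := by
    have hN : ∀ l k, ‖A l k‖ * c l k ≤ (Real.cosh θ - 1) * (if dist l k ≠ 0 then ‖A l k‖ else 0) :=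
      fun l k => by rw [hc]; exact norm_mul_cosh_sub_one_le dist A hrange hθ l k (hρlk l k)
    have hrowN : ∀ l, ∑ k, ‖A l k‖ * c l k ≤ (Real.cosh θ - 1) * h := fun l =>
      calc ∑ k, ‖A l k‖ * c l k ≤ ∑ k, (Real.cosh θ - 1) * (if dist l k ≠ 0 then ‖A l k‖ else 0) :=
            sum_le_sum fun k _ => hN l k
        _ = (Real.cosh θ - 1) * ∑ k ∈ univ.filter (fun k => dist l k ≠ 0), ‖A l k‖ := by
            rw [← mul_sum, sum_filter]
        _ ≤ (Real.cosh θ - 1) * h :=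
            mul_le_mul_of_nonneg_left (hrow l) (by linarith [Real.one_le_cosh θ])
    have hcolN : ∀ k, ∑ l, ‖A l k‖ * c l k ≤ (Real.cosh θ - 1) * h := fun k =>
      calc ∑ l, ‖A l k‖ * c l k ≤ ∑ l, (Real.cosh θ - 1) * (if dist l k ≠ 0 then ‖A l k‖ else 0) :=
            sum_le_sum fun l _ => hN l k
        _ = (Real.cosh θ - 1) * ∑ l ∈ univ.filter (fun l => dist l k ≠ 0), ‖A l k‖ := by
            rw [← mul_sum, sum_filter]
        _ ≤ (Real.cosh θ - 1) * h :=
            mul_le_mul_of_nonneg_left (hcol k) (by linarith [Real.one_le_cosh θ])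
    calc |(∑ l, ∑ k, star (v l) * (A l k * (c l k : ℂ) * v k)).re|
        ≤ ‖∑ l, ∑ k, star (v l) * (A l k * (c l k : ℂ) * v k)‖ := Complex.abs_re_le_norm _
      _ ≤ ∑ l, ‖∑ k, star (v l) * (A l k * (c l k : ℂ) * v k)‖ := norm_sum_le _ _
      _ ≤ ∑ l, ∑ k, ‖star (v l) * (A l k * (c l k : ℂ) * v k)‖ := sum_le_sum fun l _ => norm_sum_le _ _
      _ = ∑ l, ∑ k, ‖v l‖ * (‖A l k‖ * c l k) * ‖v k‖ := by
          refine sum_congr rfl fun l _ => sum_congr rfl fun k _ => ?_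
          rw [norm_mul, norm_mul, norm_mul, norm_star, Complex.norm_real, Real.norm_eq_abs,
            abs_of_nonneg (hc0 l k)]
          ring
      _ ≤ (Real.cosh θ - 1) * h * ∑ k, ‖v k‖ ^ 2 :=
          sum_sum_mul_le_of_rowSum_le_of_colSum_le (fun l k => ‖A l k‖ * c l k)
            (fun l k => mul_nonneg (norm_nonneg _) (hc0 l k)) hrowN hcolN (fun k => ‖v k‖)
      _ = h * (Real.cosh θ - 1) * S := by rw [hS]; ring
  -- (7) the odd part by symmetrization + Schur: `|Re Q_s| ≤ h_K sinh θ·S`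
  have hQs : |(∑ l, ∑ k, star (v l) * (A l k * (s l k : ℂ) * v k)).re| ≤ hK * Real.sinh θ * S := by
    -- `T + conj T = Σ conj(v_l) (A_{lk} − conj A_{kl}) s_{lk} v_k`
    have hsym : (∑ l, ∑ k, star (v l) * (A l k * (s l k : ℂ) * v k)) +
        star (∑ l, ∑ k, star (v l) * (A l k * (s l k : ℂ) * v k)) =
          ∑ l, ∑ k, star (v l) * ((A l k - star (A k l)) * (s l k : ℂ) * v k) := by
      rw [star_sum]
      simp_rw [star_sum]
      rw [sum_comm (f := fun l k => star (star (v l) * (A l k * (s l k : ℂ) * v k))), ← sum_add_distrib]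
      refine sum_congr rfl fun l _ => ?_
      rw [← sum_add_distrib]
      refine sum_congr rfl fun k _ => ?_
      rw [star_mul', star_mul', star_mul', star_star, Complex.star_def, Complex.conj_ofReal, hsanti l k,
        Complex.ofReal_neg]
      ring
    have hre : (∑ l, ∑ k, star (v l) * (A l k * (s l k : ℂ) * v k)).re =
        (∑ l, ∑ k, star (v l) * ((A l k - star (A k l)) * (s l k : ℂ) * v k)).re / 2 := by
      rw [← hsym, Complex.add_re, Complex.star_def, Complex.conj_re]; ring
    -- Schur for the kernel `‖A_{lk} − conj A_{kl}‖·|s_{lk}|`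
    have hN : ∀ l k, ‖A l k - star (A k l)‖ * |s l k| ≤
        Real.sinh θ * (if dist l k ≠ 0 then ‖A l k - star (A k l)‖ else 0) :=
      fun l k => by rw [hs]; exact norm_sub_star_mul_abs_sinh_le dist hds A hrange hθ l k (hρlk l k)
    have hsinh0 : 0 ≤ Real.sinh θ := Real.sinh_nonneg_iff.2 hθ
    have hrowN : ∀ l, ∑ k, ‖A l k - star (A k l)‖ * |s l k| ≤ Real.sinh θ * (2 * hK) := fun l =>
      calc ∑ k, ‖A l k - star (A k l)‖ * |s l k|
          ≤ ∑ k, Real.sinh θ * (if dist l k ≠ 0 then ‖A l k - star (A k l)‖ else 0) :=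
            sum_le_sum fun k _ => hN l k
        _ = Real.sinh θ * ∑ k ∈ univ.filter (fun k => dist l k ≠ 0), ‖A l k - star (A k l)‖ := by
            rw [← mul_sum, sum_filter]
        _ ≤ Real.sinh θ * (2 * hK) := mul_le_mul_of_nonneg_left (hskew l) hsinh0
    have hswap : ∀ l k, ‖A l k - star (A k l)‖ * |s l k| = ‖A k l - star (A l k)‖ * |s k l| := by
      intro l k
      rw [hsanti l k, abs_neg, ← norm_star (A l k - star (A k l)), star_sub, star_star, norm_sub_rev]
    have hcolN : ∀ k, ∑ l, ‖A l k - star (A k l)‖ * |s l k| ≤ Real.sinh θ * (2 * hK) := fun k => by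
      simp_rw [hswap _ k]; exact hrowN k
    have hQK : |(∑ l, ∑ k, star (v l) * ((A l k - star (A k l)) * (s l k : ℂ) * v k)).re| ≤
        Real.sinh θ * (2 * hK) * S :=
      calc |(∑ l, ∑ k, star (v l) * ((A l k - star (A k l)) * (s l k : ℂ) * v k)).re|
          ≤ ‖∑ l, ∑ k, star (v l) * ((A l k - star (A k l)) * (s l k : ℂ) * v k)‖ :=
            Complex.abs_re_le_norm _
        _ ≤ ∑ l, ‖∑ k, star (v l) * ((A l k - star (A k l)) * (s l k : ℂ) * v k)‖ := norm_sum_le _ _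
        _ ≤ ∑ l, ∑ k, ‖star (v l) * ((A l k - star (A k l)) * (s l k : ℂ) * v k)‖ :=
            sum_le_sum fun l _ => norm_sum_le _ _
        _ = ∑ l, ∑ k, ‖v l‖ * (‖A l k - star (A k l)‖ * |s l k|) * ‖v k‖ := by
            refine sum_congr rfl fun l _ => sum_congr rfl fun k _ => ?_
            rw [norm_mul, norm_mul, norm_mul, norm_star, Complex.norm_real, Real.norm_eq_abs]
            ring
        _ ≤ Real.sinh θ * (2 * hK) * ∑ k, ‖v k‖ ^ 2 :=
            sum_sum_mul_le_of_rowSum_le_of_colSum_le (fun l k => ‖A l k - star (A k l)‖ * |s l k|)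
              (fun l k => mul_nonneg (norm_nonneg _) (abs_nonneg _)) hrowN hcolN (fun k => ‖v k‖)
        _ = Real.sinh θ * (2 * hK) * S := by rw [hS]
    rw [hre, abs_div, abs_two]
    calc |(∑ l, ∑ k, star (v l) * ((A l k - star (A k l)) * (s l k : ℂ) * v k)).re| / 2
        ≤ Real.sinh θ * (2 * hK) * S / 2 := by gcongr
      _ = hK * Real.sinh θ * S := by ring
  -- (8) `(m∕2)·S ≤ |⟨v, f⟩| ≤ √S·√F`, hence `(m∕2)²·S ≤ F`
  have hmain : m / 2 * S ≤ ‖star v ⬝ᵥ f‖ := by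
    have h1 := hacc v
    rw [hdecomp] at h1
    have h2 : (∑ l, star (v l) * f l).re ≤ ‖star v ⬝ᵥ f‖ := Complex.re_le_norm _
    have h3 := neg_abs_le (∑ l, ∑ k, star (v l) * (A l k * (c l k : ℂ) * v k)).re
    have h4 := neg_abs_le (∑ l, ∑ k, star (v l) * (A l k * (s l k : ℂ) * v k)).re
    have h5 : (h * (Real.cosh θ - 1) + hK * Real.sinh θ) * S ≤ m / 2 * S :=
      mul_le_mul_of_nonneg_right hsm hS0
    nlinarith [hQc, hQs]
  have hSF : (m / 2) ^ 2 * S ≤ F := by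
    have h1 : m / 2 * S ≤ Real.sqrt S * Real.sqrt F :=
      hmain.trans (norm_star_dotProduct_le_sqrt_mul_sqrt v f)
    have h2 : (m / 2 * S) ^ 2 ≤ S * F := by
      calc (m / 2 * S) ^ 2 ≤ (Real.sqrt S * Real.sqrt F) ^ 2 :=
            pow_le_pow_left₀ (by positivity) h1 2
        _ = S * F := by rw [mul_pow, Real.sq_sqrt hS0, Real.sq_sqrt hF0]
    by_cases hS00 : S = 0
    · rw [hS00, mul_zero]; exact hF0
    · have hSpos : 0 < S := lt_of_le_of_ne hS0 (Ne.symm hS00)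
      have h3 : (m / 2) ^ 2 * S * S ≤ F * S := by nlinarith
      exact le_of_mul_le_mul_right h3 hSpos
  -- (9) undo the weight on `X`: `e^{θn}|x_i| ≤ |v_i|` for `i ∈ X`
  have hxi : ∀ i ∈ X, ‖x i‖ ^ 2 ≤ Real.exp (-(θ * n)) ^ 2 * ‖v i‖ ^ 2 := by
    intro i hi
    have hnvi : ‖v i‖ = d i * ‖x i‖ := by
      rw [hv, norm_mul, Complex.norm_real, Real.norm_eq_abs, abs_of_pos (hdpos i)]
    have hdi : Real.exp (θ * n) ≤ d i := by
      rw [hd]; exact Real.exp_le_exp.2 (mul_le_mul_of_nonneg_left (hρX i hi) hθ)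
    have h1 : Real.exp (θ * n) * ‖x i‖ ≤ ‖v i‖ := by
      rw [hnvi]; exact mul_le_mul_of_nonneg_right hdi (norm_nonneg _)
    have h2 : ‖x i‖ ≤ Real.exp (-(θ * n)) * ‖v i‖ := by
      rw [Real.exp_neg, ← div_eq_inv_mul, le_div_iff₀ (Real.exp_pos _), mul_comm]
      exact h1
    calc ‖x i‖ ^ 2 ≤ (Real.exp (-(θ * n)) * ‖v i‖) ^ 2 := pow_le_pow_left₀ (norm_nonneg _) h2 2
      _ = Real.exp (-(θ * n)) ^ 2 * ‖v i‖ ^ 2 := by ring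
  rw [← hx]
  calc ∑ i ∈ X, ‖x i‖ ^ 2 ≤ ∑ i ∈ X, Real.exp (-(θ * n)) ^ 2 * ‖v i‖ ^ 2 := sum_le_sum hxi
    _ = Real.exp (-(θ * n)) ^ 2 * ∑ i ∈ X, ‖v i‖ ^ 2 := by rw [mul_sum]
    _ ≤ Real.exp (-(θ * n)) ^ 2 * S :=
        mul_le_mul_of_nonneg_left
          (sum_le_univ_sum_of_nonneg fun k => by positivity) (by positivity)
    _ ≤ Real.exp (-(θ * n)) ^ 2 * (F / (m / 2) ^ 2) := by
        refine mul_le_mul_of_nonneg_left ?_ (by positivity)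
        rw [le_div_iff₀ (by positivity)]; linarith [hSF]
    _ = (2 / m * Real.exp (-(θ * n))) ^ 2 * F := by
        field_simp

/-- **The second-order (Hermitian ∕ skew-split) Combes–Thomas bound, ENTRY form**: under the hypotheses of
`secondOrder_combes_thomas_sets`, `|A⁻¹ᵢⱼ| ≤ (2∕m)e^{−θ·dist(i,j)}` for all `i, j` (the block form with `Y = {j}`, `f = e_j`,
`X = {i}`, `n = dist(i,j)`).  At `h_K = h` this is the tree's `accretive_combes_thomas` (`cosh θ + sinh θ − 1 = e^θ − 1`); for a
Hermitian `A` (`h_K = 0`) the admissible rate is `θ ≍ √(m∕h)` against the first-order `θ ≍ m∕(2h)`. [folklore] -/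
theorem secondOrder_combes_thomas (dist : ι → ι → ℕ) (hd0 : ∀ i, dist i i = 0)
    (hds : ∀ i j, dist i j = dist j i) (hdt : ∀ i j k, dist i k ≤ dist i j + dist j k)
    (A : Matrix ι ι ℂ) (hrange : ∀ i j, A i j ≠ 0 → dist i j ≤ 1) (h : ℝ)
    (hrow : ∀ i, ∑ j ∈ univ.filter (fun j => dist i j ≠ 0), ‖A i j‖ ≤ h)
    (hcol : ∀ j, ∑ i ∈ univ.filter (fun i => dist i j ≠ 0), ‖A i j‖ ≤ h)
    (hK : ℝ) (hskew : ∀ i, ∑ j ∈ univ.filter (fun j => dist i j ≠ 0), ‖A i j - star (A j i)‖ ≤ 2 * hK)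
    (m θ : ℝ) (hm : 0 < m) (hθ : 0 ≤ θ)
    (hacc : ∀ v : ι → ℂ, m * ∑ i, ‖v i‖ ^ 2 ≤ (∑ i, star (v i) * (A *ᵥ v) i).re)
    (hsm : h * (Real.cosh θ - 1) + hK * Real.sinh θ ≤ m / 2) :
    IsUnit A.det ∧ ∀ i j, ‖A⁻¹ i j‖ ≤ 2 / m * Real.exp (-(θ * dist i j)) := by
  have H := fun i j => secondOrder_combes_thomas_sets dist hd0 hds hdt A hrange h hrow hcol hK hskew m θ hm hθ hacc hsm
    {j} (Pi.single j 1) (fun k hk => Pi.single_eq_of_ne (by simpa using hk) _) {i} (dist i j)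
    (fun i' hi' y hy => by rw [mem_singleton.mp hi', mem_singleton.mp hy])
  have hdet : IsUnit A.det :=
    (accretive_combes_thomas dist hd0 hds hdt A hrange h hrow hcol m 0 hm le_rfl hacc
      (by rw [Real.exp_zero, sub_self, mul_zero]; linarith)).1
  refine ⟨hdet, fun i j => ?_⟩
  have h1 := (H i j).2
  rw [sum_singleton, Matrix.mulVec_single_one, Matrix.col_apply] at h1
  have h2 : ∑ k, ‖(Pi.single j 1 : ι → ℂ) k‖ ^ 2 = 1 := by
    rw [Finset.sum_eq_single j (fun l _ hl => by simp [Pi.single_eq_of_ne hl]) (by simp)]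
    simp
  rw [h2, mul_one] at h1
  exact (pow_le_pow_iff_left₀ (norm_nonneg _) (by positivity) two_ne_zero).mp h1

end Main

end Summit.QuantumFields.BalabanUV.T4Continuum.ShellMeasurePropagatorCombesThomas

end
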